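import Mathlib
import HarnessLib
import Literature.Computability.AlgebraicComplexity.MonotoneStructure

/-!
# Balanced decomposition of the top homogeneous component of a monotone circuit value
(crux `stmt-ValiantsHypothesis-15886`, line `Sketch`, registered stub
`stub_balancedDecomposition_topComponent`, Theorem β, B1)

Helper file (`--supports stmt-ValiantsHypothesis-15886`) of line `Sketch` of the crux
`Summit.ValiantsHypothesis.ValiantsHypothesis.Theses.MonotoneRestoration.MonotoneRestorationQP`.

The tree's structure theorem for monotone circuits
(`Literature.Computability.AlgebraicComplexity.DepthReduction.SLP.exists_balanced_decomposition`,
CDGM 2022, Thm. 2.1, in the Valiant–Skyum–Berkowitz–Rackoff frontier form) assumes that the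
computed polynomial `p` itself is fully ordered (set-multilinear) in `n ≥ 3` rows. Here the same
conclusion is obtained for the *top homogeneous component* `q = p^{(n)}` of the value `p` of a
fan-in-two circuit over `ℝ≥0`, assuming only that `q` is fully ordered: `q = Σ_t a_t · b_t` with
at most `4 · size · (n+1)²` terms, `a_t` ordered with a row set `A_t`, `b_t` with `A_tᶜ`,
`n < 3 |A_t| ≤ 2 n`, and `a_t b_t ≤ q` coefficientwise.

Proof: verbatim the tree proof — homogenize the straight-line program in degree `n`
(`SLP.homogenize`); the output node `(i, Q n)` of the homogenized program has value exactly
`homogeneousComponent n (S.val i) = q` (`SLP.hval_Q`), so no homogeneity of `p` is needed; expand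
this node along the frontier `F_{⌊2n/3⌋}` (`HomCircuit.val_eq_sum_frontier`), put
`a_μ := [μ_heavy]`, `b_μ := [q : μ] · [μ_light]`; over `ℝ≥0` nothing cancels.

## Main statements

* `TopComponentStructure.slp_balancedDecomposition_topComponent` — the straight-line-program
  version (`S : DepthReduction.SLP ℝ≥0 (ι × κ)`, `i < S.len`);
* `stub_balancedDecomposition_topComponent` — the registered stub (fan-in-two `ArithCircuit`
  over `ℝ≥0`, via `DepthReduction.exists_slp`).
-/

-- `ValiantsHypothesis.ValiantsHypothesis`: the D-0017 layout repeats the problem name in the path.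
set_option linter.dupNamespace false

noncomputable section

namespace Summit.ValiantsHypothesis.ValiantsHypothesis.Theorems

open Literature.Computability.AlgebraicComplexity MvPolynomial
open scoped NNReal

namespace TopComponentStructure

/-- **Structure theorem for the top homogeneous component of a monotone straight-line program.**
If the degree-`n` homogeneous component `q` of a value `S.val i` of a straight-line program of
length `s` over `ℝ≥0` is fully ordered in the `n ≥ 3` rows, then `q = Σ_t a_t · b_t` with at
most `4 s (n+1)²` terms, `a_t` ordered with a row set `A_t`, `n/3 < |A_t| ≤ 2n/3`, `b_t` ordered
with the complementary row set, and `a_t b_t ≤ q` coefficientwise. (Adapted from the tree's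
`DepthReduction.SLP.exists_balanced_decomposition`: the output node `(i, Q n)` of the
homogenized program has value `q` by `SLP.hval_Q`.)
[cite: ChattopadhyayDattaGhosalMukhopadhyay2022, §2, Thm. 2.1] -/
theorem slp_balancedDecomposition_topComponent {ι κ : Type*} [Fintype ι] [DecidableEq ι]
    (S : DepthReduction.SLP ℝ≥0 (ι × κ)) {i : ℕ} (hi : i < S.len)
    (hord : IsFullyOrdered (homogeneousComponent (Fintype.card ι) (S.val i)))
    (hn : 3 ≤ Fintype.card ι) :
    ∃ L : List (Finset ι × MvPolynomial (ι × κ) ℝ≥0 × MvPolynomial (ι × κ) ℝ≥0),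
      L.length ≤ 4 * S.len * (Fintype.card ι + 1) ^ 2 ∧
      (L.map fun t => t.2.1 * t.2.2).sum = homogeneousComponent (Fintype.card ι) (S.val i) ∧
      ∀ t ∈ L, IsOrdered t.1 t.2.1 ∧ IsOrdered t.1ᶜ t.2.2 ∧
        Fintype.card ι < 3 * t.1.card ∧ 3 * t.1.card ≤ 2 * Fintype.card ι ∧
        ∀ m, coeff m (t.2.1 * t.2.2) ≤
          coeff m (homogeneousComponent (Fintype.card ι) (S.val i)) := by
  classical
  -- adapted from Literature.Computability.AlgebraicComplexity.MonotoneStructure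
  -- (`DepthReduction.SLP.exists_balanced_decomposition`)
  set n := Fintype.card ι with hn_def
  set q := homogeneousComponent n (S.val i) with hq_def
  -- the homogenized program and the output node
  set H := S.homogenize n with hH
  let α : S.Node n := (⟨i, hi⟩, DepthReduction.SLP.Tag.Q (Fin.last n))
  have hval : H.val α = q := by
    change S.hval n (⟨i, hi⟩, DepthReduction.SLP.Tag.Q (Fin.last n)) = q
    rw [DepthReduction.SLP.hval_Q]
    rfl
  have hdegα : H.deg α = n := rfl
  set m := 2 * n / 3 with hm_def
  have hm1 : 1 ≤ m := by omega
  have hmn : m < H.deg α := by rw [hdegα]; omega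
  have key := H.val_eq_sum_frontier hm1 hmn
  rw [hval] at key
  -- the factors attached to a frontier gate
  let hv : S.Node n → S.Node n := fun μ => H.heavy (H.children μ).1 (H.children μ).2
  let lt : S.Node n → S.Node n := fun μ => H.light (H.children μ).1 (H.children μ).2
  let a : S.Node n → MvPolynomial (ι × κ) ℝ≥0 := fun μ => H.val (hv μ)
  let b : S.Node n → MvPolynomial (ι × κ) ℝ≥0 := fun μ => H.quot α μ * H.val (lt μ)
  have hterm : ∀ μ ∈ H.frontier m, H.quot α μ * H.val μ = a μ * b μ := by
    intro μ hμ
    obtain ⟨hk, -, -, -⟩ := H.of_mem_frontier hμ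
    change H.quot α μ * H.val μ = H.val (hv μ) * (H.quot α μ * H.val (lt μ))
    rw [H.val_prod_eq hk]
    ring
  have key' : q = ∑ μ ∈ H.frontier m, a μ * b μ := key.trans (Finset.sum_congr rfl hterm)
  set T := (H.frontier m).filter fun μ => a μ * b μ ≠ 0 with hT
  have hsumT : ∑ μ ∈ T, a μ * b μ = q := by
    rw [hT, Finset.sum_filter_ne_zero, ← key']
  have hle : ∀ μ ∈ T, ∀ mm, coeff mm (a μ * b μ) ≤ coeff mm q := by
    intro μ hμ mm
    rw [← hsumT]
    exact coeff_le_coeff_sum T (fun μ => a μ * b μ) hμ mm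
  have hfo : ∀ μ ∈ T, IsFullyOrdered (a μ * b μ) := by
    intro μ hμ mm hmm
    apply hord mm
    rw [mem_support_iff] at hmm ⊢
    exact fun h0 => hmm (le_antisymm ((hle μ hμ mm).trans h0.le) zero_le)
  have hex : ∀ μ ∈ T, ∃ A : Finset ι, IsOrdered A (a μ) ∧ IsOrdered Aᶜ (b μ) := by
    intro μ hμ
    exact exists_isOrdered_of_mul (hfo μ hμ) (Finset.mem_filter.1 hμ).2
  choose! A hA using hex
  -- balance of the row sets
  have hcard : ∀ μ ∈ T, n < 3 * (A μ).card ∧ 3 * (A μ).card ≤ 2 * n := by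
    intro μ hμ
    have hμF : μ ∈ H.frontier m := (Finset.mem_filter.1 hμ).1
    have hne : a μ * b μ ≠ 0 := (Finset.mem_filter.1 hμ).2
    have ha0 : a μ ≠ 0 := fun h0 => hne (by rw [h0, zero_mul])
    obtain ⟨hk, hdμ, h1, h2⟩ := H.of_mem_frontier hμF
    have hc : (A μ).card = H.deg (hv μ) :=
      card_eq_of_isOrdered (hA μ hμ).1 (S.isHomogeneous_homogenize_val n (hv μ)) ha0
    have hdeg := H.deg_prod_eq hk
    have hll := H.deg_light_le (H.children μ).1 (H.children μ).2
    have hhm := H.deg_heavy_le_of h1 h2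
    change H.deg μ = H.deg (lt μ) + H.deg (hv μ) at hdeg
    change H.deg (lt μ) ≤ H.deg (hv μ) at hll
    change H.deg (hv μ) ≤ m at hhm
    rw [hc]
    omega
  refine ⟨T.toList.map fun μ => (A μ, a μ, b μ), ?_, ?_, ?_⟩
  · rw [List.length_map, Finset.length_toList]
    exact (Finset.card_le_univ T).trans (S.card_node_le n)
  · rw [List.map_map, ← hsumT, ← Finset.sum_map_toList]
    rfl
  · intro t ht
    obtain ⟨μ, hμ, rfl⟩ := List.mem_map.1 ht
    rw [Finset.mem_toList] at hμ
    exact ⟨(hA μ hμ).1, (hA μ hμ).2, (hcard μ hμ).1, (hcard μ hμ).2, hle μ hμ⟩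

end TopComponentStructure

/-- **B1 — balanced decomposition of the top homogeneous component** (structure theorem for
monotone arithmetic circuits, CDGM 2022 Thm. 2.1, applied to the top component). If a
fan-in-two circuit of size `s` over the semiring `ℝ≥0` (hence monotone) computes `p`, and the
degree-`n` homogeneous component `q` of `p` is fully ordered in the `n ≥ 3` rows, then
`q = Σ_t a_t · b_t` with at most `4 s (n+1)²` terms, where `a_t` is ordered with a row set `A_t`,
`b_t` with `A_tᶜ`, `n < 3 |A_t| ≤ 2 n`, and `a_t b_t ≤ q` coefficientwise. (If the circuit
outputs a variable or a constant, `q = 0` and the empty decomposition works.)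
[cite: ChattopadhyayDattaGhosalMukhopadhyay2022, §2, Thm. 2.1] -/
theorem stub_balancedDecomposition_topComponent {ι κ : Type*} [Fintype ι] [DecidableEq ι]
    (P : ArithCircuit NNReal (ι × κ)) (hP : P.IsFanInTwo) {p : MvPolynomial (ι × κ) NNReal}
    (hc : P.Computes p)
    (hord : IsFullyOrdered (MvPolynomial.homogeneousComponent (Fintype.card ι) p))
    (hn : 3 ≤ Fintype.card ι) :
    ∃ L : List (Finset ι × MvPolynomial (ι × κ) NNReal × MvPolynomial (ι × κ) NNReal),
      L.length ≤ 4 * P.size * (Fintype.card ι + 1) ^ 2 ∧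
      (L.map fun t => t.2.1 * t.2.2).sum = MvPolynomial.homogeneousComponent (Fintype.card ι) p ∧
      ∀ t ∈ L, IsOrdered t.1 t.2.1 ∧ IsOrdered t.1ᶜ t.2.2 ∧
        Fintype.card ι < 3 * t.1.card ∧ 3 * t.1.card ≤ 2 * Fintype.card ι ∧
        ∀ m, MvPolynomial.coeff m (t.2.1 * t.2.2) ≤
          MvPolynomial.coeff m (MvPolynomial.homogeneousComponent (Fintype.card ι) p) := by
  obtain ⟨S, hlen, h⟩ := DepthReduction.exists_slp P hP
  unfold ArithCircuit.Computes at hc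
  rcases h with ⟨i, hi, hval⟩ | ⟨j, hj⟩ | ⟨c, hcC⟩
  · rw [← hc, hval, ← hlen]
    rw [← hc, hval] at hord
    exact TopComponentStructure.slp_balancedDecomposition_topComponent S hi hord hn
  · have h0 : MvPolynomial.homogeneousComponent (Fintype.card ι) p = 0 := by
      rw [← hc, hj, homogeneousComponent_of_mem (isHomogeneous_X _ _), if_neg (by omega)]
    refine ⟨[], by simp, ?_, by simp⟩
    rw [h0]
    simp
  · have h0 : MvPolynomial.homogeneousComponent (Fintype.card ι) p = 0 := by
      rw [← hc, hcC, homogeneousComponent_of_mem (isHomogeneous_C _ _), if_neg (by omega)]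
    refine ⟨[], by simp, ?_, by simp⟩
    rw [h0]
    simp

end Summit.ValiantsHypothesis.ValiantsHypothesis.Theorems
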